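import Literature.NumberTheory.Automorphic.Liu2021.LemD1AsPrintedIndexedNonVacuity
import HarnessLib

/-!
# [Liu2021, App. D Lemma D.1 (1) ∧ (3)] as printed on an INDEXED collection — the three slots `μ`, `ε`, `χ` of item (3)
# exercised separately, and the two records shown independent (kernel certificates; `E^{−×}/Nm E^×` made honest)

Reproduction ∕ bookkeeping (Literature, theorems only, no record, no definition, nothing asserted about Liu's objects).
Sequel of `LemD1AsPrintedIndexedNonVacuity.lean`, whose certificate exercises item (3) of Lemma D.1 («If `n ≥ 3`, then
`ω(μ', ε', χ')` is isomorphic to `ω(μ, ε, χ)` if and only if `(μ', ε', χ') = (μ, ε, χ)`», typed as `LemD1_3AsPrintedI`: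
`ω_j ≅ ω_i ↔ μ_j = μ_i ∧ SameClass ε_i ε_j ∧ χ_j = χ_i`) only through the `μ`-slot (its two members share `ε` and `χ`).
This file adds what that certificate does not give:

* §1 **READING L3′ is an honest quotient.** `LemD1.SameClass e e'` («`e' = (x x^c) e` for some `x ∈ E^×`», equality in
  `E^{−×}/Nm_{E/F} E^×`) is an EQUIVALENCE RELATION on the Step-1 representatives (reflexive, symmetric, transitive), for
  every standing datum `S`; hence the orientation of the `ε`-conjunct in `LemD1_3AsPrinted(I)` is immaterial
  (`LemD1.sameClass_comm`), and `Quot LemD1.SameClass` — the local parameter space of `LemD1LocalInjectivity.lean` — is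
  EXACTLY the printed set `E^{−×}/Nm E^×` (`LemD1.quotMk_eq_iff_sameClass`: no `EqvGen` closure is silently added).
* §2 At a SPLIT place (`E = F × F`, the tree's `splitData`) every two representatives lie in ONE class
  (`LemD1.sameClass_of_splitData`: `(a', −a') = x x^c (a, −a)` with `x = (a'/a, 1)`) — so a certificate over a split datum
  can exercise «`ε' ≠ ε` in `E^{−×}/Nm`» only vacuously; this is recorded, not hidden.
* §4 **The slot-wise certificate** (`exists_lemD1IndexedFamily_slots`): at a split place, `n = 3`, ONE four-member collection
  satisfying `Item1AsPrinted ∧ LemD1_3AsPrintedI` in which, relative to member `0 = (1, ε, 1; trivial line)`: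
  member `1` differs ONLY in `μ` (and is non-isomorphic), member `2` differs ONLY in `χ` (and is non-isomorphic), member `3`
  differs ONLY in the REPRESENTATIVE of `ε` (`(ϖ, −ϖ)` versus `(1, −1)`, same class) and IS isomorphic; members `1`, `2` are
  mutually non-isomorphic.  So each slot of the printed triple-equality is witnessed at both truth values in one model, and
  item (3) as typed identifies representatives of one class (corollaries `not_forall_chi_eq_…`, `not_forall_eps_eq_…`).
* §5 **Independence of the two records by shape**: a collection with `Item1AsPrinted ∧ ¬ LemD1_3AsPrintedI` (equal labels on
  non-isomorphic carriers) and one with `LemD1_3AsPrintedI ∧ ¬ Item1AsPrinted` (a non-zero line whose maximal `χ`-quotient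
  vanishes because `χ` disagrees with the central action — item (1) forbids a zero `ω(μ, ε, χ)` at `n = 3`).

THE WITNESSES (split case of Liu's proof, l. 5241: «We identify `U(V)` with `GL_n(F)` … through the first factor»): `F = K_v`,
`E = F × F` with the swap, Gram `(1, 1)`, `U(V)(F) ≅ GL₃(F)`, `E¹ ≅ F^×`; unramified characters `θ_q(x) = q^{ord_v x}` of `F^×`
for `q = ζ₃` (`ν`, cubic) and `q = −1` (`sgn`); carriers = the lines `ℂ` with `U` acting through `1`, `ν ∘ det`, `sgn ∘ det`;
`μ₁ = ν ⊠ ν⁻¹`, i.e. `μ₁(x, y) = ν(x)/ν(y)` — Liu's own normal form of a Step-2 character at a split place («and write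
`μ = ν ⊠ ν⁻¹`», l. 5241; trivial on `F^×`, as Step 2 demands there); `χ₂(a) = sgn(a)³` on `E¹ ≅ F^×` (the central character of
`sgn ∘ det`).  §3 is the folklore criterion: two such lines have isomorphic maximal `χ`-quotients iff the characters agree.

Consequence (T5-style consistency, our bookkeeping): from `(h₁ : Lf.Item1AsPrinted) (h₃ : LemD1_3AsPrintedI Lf)` one can
derive neither `∀ i j, Lf.chi i = Lf.chi j`, nor `Lf.eps i = Lf.eps j` from `ω_j ≅ ω_i`, nor either record from the other.
It says nothing about the truth of Lemma D.1 for Liu's `ω(μ, ε)` or for the tree's constructed local data; nothing at a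
non-split datum (`E` a field, two `ε`-classes); carriers are one-dimensional.

Cell pub-hodgecm2 (COR-CM), Δ2 BRIDGE cite legs `hsep` ∕ `hμsep`, END rows `hD1″`, `hD3`; seat prover-pub-hodgecm2-b10
(the lineage that filed `LemD1AsPrintedIndexed.lean`).  HC_CM is NOT proved.

Reference: Y. Liu, *Fourier–Jacobi cycles and arithmetic relative trace formula*, Camb. J. Math. 9 (2021) = arXiv:2102.11518,
App. D §D.1 Steps 1–3 (`FJcycle.tex` l. 5213–5224, esp. Step 1 and its footnote, l. 5217), Lemma D.1 (1) (l. 5229), (3)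
(l. 5233); split case of the proof, l. 5241.
-/

noncomputable section

open Literature.RepresentationTheory.Liu2021 (OscillatorStandingData)
open Literature.RepresentationTheory.CentralCharacterQuotient (augmentation quotRep quotRep_mk)

namespace Literature.NumberTheory.Automorphic.Liu2021

/-! ## §1 `E^{−×}/Nm_{E/F} E^×` (READING L3′): `SameClass` is an equivalence relation -/

namespace LemD1

section SameClass

variable {F E : Type} [Field F] [CommRing E] [Algebra F E] {n : ℕ} {S : OscillatorStandingData F E n}

/-- `ε = ε` in `E^{−×}/Nm E^×`: `e = (1·1^c) e`. [cite: Liu2021, App. D §D.1 Step 1 (l. 5217)] -/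
theorem SameClass.refl (e : EpsRep S) : SameClass e e :=
  ⟨1, by rw [map_one, one_mul, one_mul]⟩

/-- Symmetry of «same class in `E^{−×}/Nm E^×`»: if `e' = (x x^c) e` then `e = (x⁻¹ (x⁻¹)^c) e'`.
[cite: Liu2021, App. D §D.1 Step 1 (l. 5217)] -/
theorem SameClass.symm {e e' : EpsRep S} (h : SameClass e e') : SameClass e' e := by
  obtain ⟨x, hx⟩ := h
  exact ⟨x⁻¹, by rw [map_inv, hx, ← mul_inv, inv_mul_cancel_left]⟩

/-- Transitivity of «same class in `E^{−×}/Nm E^×`»: `(y y^c)(x x^c) = (yx)(yx)^c`.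
[cite: Liu2021, App. D §D.1 Step 1 (l. 5217)] -/
theorem SameClass.trans {e e' e'' : EpsRep S} (h : SameClass e e') (h' : SameClass e' e'') : SameClass e e'' := by
  obtain ⟨x, hx⟩ := h
  obtain ⟨y, hy⟩ := h'
  exact ⟨y * x, by rw [hy, hx, map_mul, ← mul_assoc, mul_mul_mul_comm]⟩

/-- `SameClass` is an equivalence relation on the Step-1 representatives (so `E^{−×}/Nm_{E/F} E^×` is an honest quotient).
[cite: Liu2021, App. D §D.1 Step 1 (l. 5217)] -/
theorem SameClass.equivalence : Equivalence (SameClass (S := S)) :=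
  ⟨SameClass.refl, SameClass.symm, SameClass.trans⟩

/-- The orientation of «`ε' = ε`» is immaterial: `SameClass e e' ↔ SameClass e' e` (so the `ε`-conjunct of
`LemD1_3AsPrinted` ∕ `LemD1_3AsPrintedI`, written `SameClass (eps i) (eps j)`, may be read either way round).
[cite: Liu2021, App. D Lemma D.1 (3) (l. 5233)] -/
theorem sameClass_comm {e e' : EpsRep S} : SameClass e e' ↔ SameClass e' e :=
  ⟨SameClass.symm, SameClass.symm⟩

/-- **`Quot SameClass` is exactly `E^{−×}/Nm_{E/F} E^×`**: two representatives have the same image in the quotient type used as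
local parameter space (`LemD1LocalInjectivity.lean`) iff they are `SameClass` — no equivalence closure is added, because
`SameClass` already is one. [cite: Liu2021, App. D §D.1 Step 1 (l. 5217)] -/
theorem quotMk_eq_iff_sameClass {e e' : EpsRep S} :
    Quot.mk (SameClass (S := S)) e = Quot.mk (SameClass (S := S)) e' ↔ SameClass e e' :=
  ⟨fun h => SameClass.equivalence.eqvGen_iff.1 (Quot.eqvGen_exact h), fun h => Quot.sound h⟩

end SameClass

/-! ## §2 At a split place `E^{−×}/Nm E^×` is ONE point -/

section Split

open Literature.RepresentationTheory.Liu2021.SplitPlace (splitData)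

variable {F : Type} [Field F] {n : ℕ} (H₁ : Matrix (Fin n) (Fin n) F) (hH : IsUnit H₁.det) (hn : 2 ≤ n)
  (h2 : ringChar F ≠ 2)

/-- **At a split place every two Step-1 representatives lie in the same class of `E^{−×}/Nm E^×`**: `E^− = {(a, −a)}`,
and `(a', −a') = x x^c · (a, −a)` with `x = (a'/a, 1)`, `x^c = (1, a'/a)`.  (So «`ε' ≠ ε`» of Lemma D.1 (3)/(4) is void at split
places — consistent with the split case of the proof, l. 5241, whose description of `ω(μ, ε, χ)` as a unitary induction from
`Q_{n−1,1}(F)` does not involve `ε`.)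
[cite: Liu2021, App. D §D.1 Step 1 (l. 5217) and proof of Lemma D.1, split case (l. 5241)] -/
theorem sameClass_of_splitData (e e' : EpsRep (splitData H₁ hH hn h2)) : SameClass e e' := by
  have he : ((e.1 : (F × F)ˣ) : F × F).2 = -((e.1 : (F × F)ˣ) : F × F).1 :=
    (Literature.RepresentationTheory.Liu2021.SplitPlace.mem_skew_iff H₁ hH hn h2 _).1 e.2
  have he' : ((e'.1 : (F × F)ˣ) : F × F).2 = -((e'.1 : (F × F)ˣ) : F × F).1 :=
    (Literature.RepresentationTheory.Liu2021.SplitPlace.mem_skew_iff H₁ hH hn h2 _).1 e'.2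
  have h0 : ((e.1 : (F × F)ˣ) : F × F).1 ≠ 0 := fun h0 =>
    ((Prod.isUnit_iff.1 (Units.isUnit (e.1 : (F × F)ˣ))).1.ne_zero h0).elim
  refine ⟨MulEquiv.prodUnits.symm
    (Units.map (RingHom.fst F F : F × F →* F) e'.1 / Units.map (RingHom.fst F F : F × F →* F) e.1, 1), ?_⟩
  apply Units.ext
  refine Prod.ext ?_ ?_
  · simp [MulEquiv.prodUnits, OscillatorStandingData.σ, div_mul_cancel₀ _ h0]
  · simp [MulEquiv.prodUnits, OscillatorStandingData.σ, he, he', div_mul_cancel₀ _ h0]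

end Split

end LemD1

/-! ## §3 Character lines: maximal `χ`-quotients are isomorphic iff the characters agree -/

namespace LemD1IndexedNonVacuitySlots

section Character

variable {G Z : Type*} [Group G] [Group Z]

/-- If `G` acts on the line `ℂ` through a character `λ` agreeing with `χ` on the central subgroup `ζ(Z)`, the
`χ`-augmentation submodule vanishes (the maximal `χ`-quotient is the line itself). [folklore] -/
private theorem augmentation_eq_bot_of_character (ρ : Representation ℂ G ℂ) (ζ : Z →* G) (χ : Z →* ℂˣ) (lam : G →* ℂˣ)
    (h : ∀ (g : G) (x : ℂ), ρ g x = (lam g : ℂ) * x) (hcen : ∀ z, lam (ζ z) = χ z) : augmentation ρ ζ χ = ⊥ := by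
  unfold augmentation
  refine iSup_eq_bot.2 fun z => ?_
  rw [LinearMap.range_eq_bot]
  ext
  simp [h, hcen]

/-- **Two character lines have isomorphic maximal `χ`-quotients iff the characters coincide** (both quotients being the
lines themselves): an intertwiner carries the non-zero class of `1` to a non-zero vector on which `g` acts by `λ₁ g` and by
`λ₂ g` at once; conversely equal characters are intertwined by the identity of `ℂ`. [folklore] -/
private theorem areIsomorphicRep_quotRep_iff_of_character (ρ₁ ρ₂ : Representation ℂ G ℂ) {ζ : Z →* G}
    (hζ : ∀ z, ζ z ∈ Subgroup.center G) (χ₁ χ₂ : Z →* ℂˣ) (lam₁ lam₂ : G →* ℂˣ)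
    (h₁ : ∀ (g : G) (x : ℂ), ρ₁ g x = (lam₁ g : ℂ) * x) (h₂ : ∀ (g : G) (x : ℂ), ρ₂ g x = (lam₂ g : ℂ) * x)
    (hN₁ : augmentation ρ₁ ζ χ₁ = ⊥) (hN₂ : augmentation ρ₂ ζ χ₂ = ⊥) :
    AreIsomorphicRep (quotRep ρ₁ hζ χ₁) (quotRep ρ₂ hζ χ₂) ↔ lam₁ = lam₂ := by
  have hact₁ : ∀ (g : G) (u : ℂ), quotRep ρ₁ hζ χ₁ g (Submodule.Quotient.mk u) =
      (lam₁ g : ℂ) • (Submodule.Quotient.mk u : ℂ ⧸ augmentation ρ₁ ζ χ₁) := fun g u => by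
    rw [quotRep_mk, h₁, ← smul_eq_mul, Submodule.Quotient.mk_smul]
  have hact₂ : ∀ (g : G) (u : ℂ), quotRep ρ₂ hζ χ₂ g (Submodule.Quotient.mk u) =
      (lam₂ g : ℂ) • (Submodule.Quotient.mk u : ℂ ⧸ augmentation ρ₂ ζ χ₂) := fun g u => by
    rw [quotRep_mk, h₂, ← smul_eq_mul, Submodule.Quotient.mk_smul]
  constructor
  · rintro ⟨f, hf⟩
    ext g
    have hw : (Submodule.Quotient.mk 1 : ℂ ⧸ augmentation ρ₁ ζ χ₁) ≠ 0 := by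
      rw [Ne, Submodule.Quotient.mk_eq_zero, hN₁, Submodule.mem_bot]
      exact one_ne_zero
    have key := hf g (Submodule.Quotient.mk 1)
    obtain ⟨u, hu⟩ := Submodule.Quotient.mk_surjective _ (f (Submodule.Quotient.mk 1))
    rw [hact₁, map_smul, ← hu, hact₂] at key
    have hsub : ((lam₁ g : ℂ) - lam₂ g) • (Submodule.Quotient.mk u : ℂ ⧸ augmentation ρ₂ ζ χ₂) = 0 := by
      rw [sub_smul, key, sub_self]
    rcases smul_eq_zero.1 hsub with h | h
    · exact sub_eq_zero.1 h
    · exact (hw (f.injective (by rw [← hu, h, map_zero]))).elim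
  · rintro rfl
    refine ⟨(Submodule.quotEquivOfEqBot _ hN₁).trans (Submodule.quotEquivOfEqBot _ hN₂).symm, fun g w => ?_⟩
    obtain ⟨u, rfl⟩ := Submodule.Quotient.mk_surjective _ w
    rw [hact₁, map_smul, LinearEquiv.trans_apply, Submodule.quotEquivOfEqBot_apply_mk,
      Submodule.quotEquivOfEqBot_symm_apply, hact₂]

end Character

/-! ## §4 The slot-wise certificate at a split place, `n = 3` (with §5 built from the same witnesses) -/

section Certificate

open _root_.IsDedekindDomain _root_.NumberField
open scoped _root_.NumberField
open Literature.RepresentationTheory.Liu2021.SplitPlace (splitData not_isField unitaryToGL unitaryOfGL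
  unitaryToGL_unitaryOfGL unitaryEquiv_apply unitaryEquiv_scalar normOneEquiv_apply normOneToUnits
  normOneOfUnit normOneToUnits_normOneOfUnit)

variable (K : Type) [Field K] [NumberField K] (v : HeightOneSpectrum (𝓞 K))

/-- An element `ϖ ∈ K_v^×` of valuation `exp(−1)` (a uniformiser), in Mathlib's multiplicative notation: `log v(ϖ) = −1`.
[folklore] -/
private theorem exists_log_valuation_eq_neg_one :
    ∃ ϖ : (v.adicCompletion K)ˣ, WithZero.log (Valued.v (ϖ : v.adicCompletion K)) = -1 := by
  obtain ⟨π, hπ⟩ := IsDedekindDomain.HeightOneSpectrum.valuation_exists_uniformizer K v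
  have hπv : Valued.v (π : v.adicCompletion K) = WithZero.exp (-1 : ℤ) := by
    rw [IsDedekindDomain.HeightOneSpectrum.valuedAdicCompletion_eq_valuation', hπ]
  have hπ0 : (π : v.adicCompletion K) ≠ 0 := by
    intro h
    rw [h, map_zero] at hπv
    exact WithZero.exp_ne_zero hπv.symm
  exact ⟨Units.mk0 _ hπ0, by rw [Units.val_mk0, hπv, WithZero.log_exp]⟩

/-- **The unramified character `x ↦ q^{ord_v x}` of `K_v^×`** for a unit complex number `q`: a homomorphism with
`θ x = q ^ log v(x)`, unitary, continuous (locally constant), trivial on `{v(x) = 1}`.  Stated as an existence so that no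
definition is introduced. [folklore] -/
private theorem exists_unramified_character (q : ℂˣ) (hq : ‖(q : ℂ)‖ = 1) :
    ∃ θ : (v.adicCompletion K)ˣ →* ℂˣ,
      (∀ x, θ x = q ^ WithZero.log (Valued.v (x : v.adicCompletion K))) ∧
      (∀ x, ‖((θ x : ℂˣ) : ℂ)‖ = 1) ∧
      (Continuous fun x : (v.adicCompletion K)ˣ => ((θ x : ℂˣ) : ℂ)) ∧
      ∀ x : (v.adicCompletion K)ˣ, Valued.v (x : v.adicCompletion K) = 1 → θ x = 1 := by
  set f : Multiplicative ℤ →* ℂ := (Units.coeHom ℂ).comp (zpowersHom ℂˣ q) with hfdef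
  set θ₀ : (v.adicCompletion K) →*₀ ℂ :=
    (WithZero.lift' f).comp (Valued.v : Valuation (v.adicCompletion K) (WithZero (Multiplicative ℤ))).toMonoidWithZeroHom
    with hθ₀def
  have hθ₀ : ∀ x : v.adicCompletion K, x ≠ 0 → θ₀ x = ((q ^ WithZero.log (Valued.v x) : ℂˣ) : ℂ) := by
    intro x hx
    have hvx : Valued.v x ≠ 0 := (Valuation.ne_zero_iff _).2 hx
    rw [hθ₀def, MonoidWithZeroHom.comp_apply]
    change WithZero.lift' f (Valued.v x) = _
    conv_lhs => rw [← WithZero.exp_log hvx]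
    rw [show WithZero.exp (WithZero.log (Valued.v x)) =
        ((Multiplicative.ofAdd (WithZero.log (Valued.v x)) : Multiplicative ℤ) : WithZero (Multiplicative ℤ)) from rfl,
      WithZero.lift'_coe, hfdef, MonoidHom.comp_apply, zpowersHom_apply, Units.coeHom_apply]
    rfl
  set θ : (v.adicCompletion K)ˣ →* ℂˣ := Units.map θ₀.toMonoidHom with hθdef
  have hθ : ∀ x : (v.adicCompletion K)ˣ, θ x = q ^ WithZero.log (Valued.v (x : v.adicCompletion K)) := by
    intro x
    apply Units.ext
    rw [hθdef, Units.coe_map]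
    exact hθ₀ x x.ne_zero
  refine ⟨θ, hθ, fun x => ?_, ?_, fun x hx => ?_⟩
  · rw [hθ, Units.val_zpow_eq_zpow_val, norm_zpow, hq, one_zpow]
  · refine (IsLocallyConstant.iff_eventually_eq _).2 (fun x₀ => ?_) |>.continuous
    have hx₀ : Valued.v (x₀ : v.adicCompletion K) ≠ 0 := (Valuation.ne_zero_iff _).2 x₀.ne_zero
    have hnhds : {y : (v.adicCompletion K)ˣ | Valued.v (y : v.adicCompletion K) = Valued.v (x₀ : v.adicCompletion K)} ∈ nhds x₀ :=
      Units.continuous_val.continuousAt.preimage_mem_nhds (Valued.locally_const hx₀)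
    refine Filter.mem_of_superset hnhds fun y hy => ?_
    simp only [Set.mem_setOf_eq] at hy ⊢
    rw [hθ, hθ, hy]
  · rw [hθ, hx, WithZero.log_one, zpow_zero]

/-- A primitive cube root of unity `ζ₃ = e^{2πi/3}` as a unit of `ℂ`: `ζ₃³ = 1`, `ζ₃ ≠ 1`, `‖ζ₃‖ = 1`. [folklore] -/
private theorem exists_cubeRootOfUnity_unit : ∃ ζ : ℂˣ, ζ ^ 3 = 1 ∧ ζ ≠ 1 ∧ ‖(ζ : ℂ)‖ = 1 := by
  have hprim : IsPrimitiveRoot (Complex.exp (2 * Real.pi * Complex.I / (3 : ℕ))) 3 :=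
    Complex.isPrimitiveRoot_exp 3 (by norm_num)
  have hu : IsUnit (Complex.exp (2 * Real.pi * Complex.I / (3 : ℕ))) := hprim.isUnit (by norm_num)
  have hζ : IsPrimitiveRoot hu.unit 3 := IsPrimitiveRoot.coe_units_iff.1 (by rw [hu.unit_spec]; exact hprim)
  exact ⟨hu.unit, hζ.pow_eq_one, hζ.ne_one (by norm_num), by rw [hu.unit_spec]; exact hprim.norm'_eq_one (by norm_num)⟩

set_option maxHeartbeats 400000 in
-- (one `whnf` in the finalisation of the long witness context below exceeds the default budget; the declaration
-- elaborates in ≈ 10 s — twice the default suffices)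
/-- The three certificates of §4–§5, built from one set of witnesses (see the module docstring): (a) the four-member
slot-wise collection; (b) two members with identical labels on non-isomorphic carriers (item (1) holds, item (3) fails);
(c) one member whose line has zero maximal `χ`-quotient (item (3) holds, item (1) fails).
[cite: Liu2021, App. D Lemma D.1 (1) and (3)] -/
private theorem certificates :
    (∃ Lf : LemD1IndexedFamily (v.adicCompletion K) (v.adicCompletion K × v.adicCompletion K) 3 (Fin 4),
      Lf.Item1AsPrinted ∧ LemD1_3AsPrintedI Lf ∧
      (Lf.mu 1 ≠ Lf.mu 0 ∧ Lf.eps 1 = Lf.eps 0 ∧ Lf.chi 1 = Lf.chi 0 ∧ ¬ AreIsomorphicRep (Lf.quot 1) (Lf.quot 0)) ∧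
      (Lf.mu 2 = Lf.mu 0 ∧ Lf.eps 2 = Lf.eps 0 ∧ Lf.chi 2 ≠ Lf.chi 0 ∧ ¬ AreIsomorphicRep (Lf.quot 2) (Lf.quot 0)) ∧
      (Lf.mu 3 = Lf.mu 0 ∧ Lf.eps 3 ≠ Lf.eps 0 ∧ LemD1.SameClass (Lf.eps 0) (Lf.eps 3) ∧ Lf.chi 3 = Lf.chi 0 ∧
        AreIsomorphicRep (Lf.quot 3) (Lf.quot 0)) ∧
      ¬ AreIsomorphicRep (Lf.quot 2) (Lf.quot 1)) ∧
    (∃ Lf : LemD1IndexedFamily (v.adicCompletion K) (v.adicCompletion K × v.adicCompletion K) 3 (Fin 2),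
      Lf.Item1AsPrinted ∧ ¬ LemD1_3AsPrintedI Lf ∧
      Lf.mu 1 = Lf.mu 0 ∧ Lf.eps 1 = Lf.eps 0 ∧ Lf.chi 1 = Lf.chi 0 ∧ ¬ AreIsomorphicRep (Lf.quot 1) (Lf.quot 0)) ∧
    (∃ Lf : LemD1IndexedFamily (v.adicCompletion K) (v.adicCompletion K × v.adicCompletion K) 3 (Fin 1),
      LemD1_3AsPrintedI Lf ∧ ¬ Lf.Item1AsPrinted ∧ Nontrivial (Lf.V 0) ∧
      Subsingleton (Lf.V 0 ⧸ augmentation (Lf.omega 0) Lf.S.scalar (Lf.chi 0).1)) := by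
  -- the local field `F = K_v`, `E = F × F`, the split standing data `S` (Gram matrix `(1, 1)`, rank 3)
  haveI hcz : CharZero (v.adicCompletion K) := charZero_of_injective_algebraMap (algebraMap K (v.adicCompletion K)).injective
  have h2 : ringChar (v.adicCompletion K) ≠ 2 := by rw [ringChar.eq_zero]; decide
  have hH : IsUnit (1 : Matrix (Fin 3) (Fin 3) (v.adicCompletion K)).det := by simp
  have h23 : (2 : ℕ) ≤ 3 := by norm_num
  let S : OscillatorStandingData (v.adicCompletion K) (v.adicCompletion K × v.adicCompletion K) 3 := splitData 1 hH h23 h2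
  have hconj : ∀ x, S.conj x = x.swap := fun x => rfl
  -- a uniformiser `ϖ`; the unramified characters `ν = ζ₃^{ord}` (cubic) and `sgn = (−1)^{ord}`
  obtain ⟨ϖ, hϖ⟩ := exists_log_valuation_eq_neg_one K v
  obtain ⟨ζ, hζ3, hζ1, hζnorm⟩ := exists_cubeRootOfUnity_unit
  have hζne : ζ⁻¹ ≠ 1 := by rwa [Ne, inv_eq_one]
  obtain ⟨ν, hνval, hνnorm, hνcont, hνone⟩ := exists_unramified_character K v ζ hζnorm
  have hn1 : ‖((-1 : ℂˣ) : ℂ)‖ = 1 := by rw [Units.val_neg, Units.val_one, norm_neg, norm_one]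
  have hsg := exists_unramified_character K v (-1) hn1
  obtain ⟨sgn, hsval, hsnorm, hscont, hsone⟩ := hsg
  have hν3 : ∀ x, ν x ^ 3 = 1 := fun x => by
    rw [hνval, ← zpow_natCast, ← zpow_mul, mul_comm, zpow_mul, zpow_natCast, hζ3, one_zpow]
  have hνϖ : ν ϖ = ζ⁻¹ := by rw [hνval, hϖ, zpow_neg, zpow_one]
  have hsϖ : sgn ϖ = -1 := by
    rw [hsval, hϖ, zpow_neg, zpow_one]
    exact inv_eq_of_mul_eq_one_right (by rw [neg_mul_neg, one_mul])
  have hm1 : (-1 : ℂˣ) ≠ 1 := by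
    rw [Ne, Units.ext_iff, Units.val_neg, Units.val_one]; norm_num
  have hm13 : (-1 : ℂˣ) ^ 3 = -1 := by rw [pow_succ, neg_one_sq, one_mul]
  have hζm1 : ζ⁻¹ ≠ -1 := by
    intro h
    apply hm1
    calc (-1 : ℂˣ) = (-1) ^ 3 := hm13.symm
      _ = (ζ⁻¹) ^ 3 := by rw [h]
      _ = 1 := by rw [inv_pow, hζ3, inv_one]
  -- Step 1: the representatives `e = (1, −1)` and `e' = (ϖ, −ϖ)` of `E^{−×}` (one class, two representatives)
  let e : LemD1.EpsRep S :=
    ⟨MulEquiv.prodUnits.symm (1, -1), by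
      change ((MulEquiv.prodUnits.symm (1, -1) : (v.adicCompletion K × v.adicCompletion K)ˣ) :
        v.adicCompletion K × v.adicCompletion K) ∈ S.skew
      rw [S.mem_skew_iff, hconj]
      simp [MulEquiv.prodUnits]⟩
  let e' : LemD1.EpsRep S :=
    ⟨MulEquiv.prodUnits.symm (ϖ, -ϖ), by
      change ((MulEquiv.prodUnits.symm (ϖ, -ϖ) : (v.adicCompletion K × v.adicCompletion K)ˣ) :
        v.adicCompletion K × v.adicCompletion K) ∈ S.skew
      rw [S.mem_skew_iff, hconj]
      simp [MulEquiv.prodUnits]⟩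
  have hϖ1 : ϖ ≠ 1 := by
    intro h
    rw [h, Units.val_one, map_one, WithZero.log_one] at hϖ
    exact absurd hϖ (by norm_num)
  have hee' : e' ≠ e := by
    intro h
    have h1 := congrArg (fun x : LemD1.EpsRep S => (MulEquiv.prodUnits x.1).1) h
    simp only [e, e', MulEquiv.apply_symm_apply] at h1
    exact hϖ1 h1
  have hsc : ∀ a b : LemD1.EpsRep S, LemD1.SameClass a b := LemD1.sameClass_of_splitData 1 hH h23 h2
  -- Step 3: `χ₁ = 1` and `χ₂(a) = sgn(a)³` on `E¹ ≅ F^×`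
  let χ₁ : LemD1.ChiSet S := ⟨1, fun z => by simp, by simpa using continuous_const⟩
  have hcN : Continuous (normOneToUnits (1 : Matrix (Fin 3) (Fin 3) (v.adicCompletion K)) hH h23 h2) :=
    (Continuous.units_map _ (by exact continuous_fst)).comp continuous_subtype_val
  let χ₂' : S.normOne →* ℂˣ := (powMonoidHom 3).comp (sgn.comp (normOneToUnits 1 hH h23 h2))
  have hχ₂' : ∀ z, χ₂' z = sgn (normOneToUnits 1 hH h23 h2 z) ^ 3 := fun z => rfl
  let χ₂ : LemD1.ChiSet S :=
    ⟨χ₂', fun z => by rw [hχ₂', Units.val_pow_eq_pow_val, norm_pow, hsnorm, one_pow], by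
      have heq : (fun z : S.normOne => ((χ₂' z : ℂˣ) : ℂ)) =
          fun z => ((sgn (normOneToUnits 1 hH h23 h2 z) : ℂˣ) : ℂ) ^ 3 := by
        funext z; rw [hχ₂', Units.val_pow_eq_pow_val]
      rw [heq]
      exact (hscont.comp hcN).pow 3⟩
  have hχ₂ϖ : χ₂' (normOneOfUnit 1 hH h23 h2 ϖ) = -1 := by
    rw [hχ₂', normOneToUnits_normOneOfUnit, hsϖ, hm13]
  have hχne : χ₂ ≠ χ₁ := by
    intro h
    have h' := congrArg (fun χ : LemD1.ChiSet S => χ.1 (normOneOfUnit 1 hH h23 h2 ϖ)) h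
    change χ₂' (normOneOfUnit 1 hH h23 h2 ϖ) = (1 : S.normOne →* ℂˣ) (normOneOfUnit 1 hH h23 h2 ϖ) at h'
    rw [hχ₂ϖ, MonoidHom.one_apply] at h'
    exact hm1 h'
  -- Step 2: `μ₀ = 1` and `μ₁(x, y) = ν(x)/ν(y)` (at a split place every `a ∈ F^×` is the norm `(a,1)(a,1)^c`, so the
  -- printed kernel clause of Step 2 reads `μ|_{F^×} = 1`)
  have hnormRHS : ∀ a : (v.adicCompletion K)ˣ, ∃ x : (v.adicCompletion K × v.adicCompletion K)ˣ,
      (x : v.adicCompletion K × v.adicCompletion K) * S.conj x =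
        algebraMap (v.adicCompletion K) (v.adicCompletion K × v.adicCompletion K) a :=
    fun a => ⟨MulEquiv.prodUnits.symm (a, 1), by rw [hconj]; simp [MulEquiv.prodUnits, Prod.algebraMap_apply]⟩
  let μ₀ : LemD1.MuSet S :=
    ⟨1, fun x => by simp, by simpa using continuous_const, fun a => iff_of_true (by simp) (hnormRHS a)⟩
  let p₁ : (v.adicCompletion K × v.adicCompletion K)ˣ →* (v.adicCompletion K)ˣ := Units.map (RingHom.fst _ _).toMonoidHom
  let p₂ : (v.adicCompletion K × v.adicCompletion K)ˣ →* (v.adicCompletion K)ˣ := Units.map (RingHom.snd _ _).toMonoidHom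
  let μ₁' : (v.adicCompletion K × v.adicCompletion K)ˣ →* ℂˣ := ν.comp p₁ / ν.comp p₂
  have hμ₁' : ∀ x, μ₁' x = ν (p₁ x) / ν (p₂ x) := fun x => rfl
  have hp_alg : ∀ a : (v.adicCompletion K)ˣ,
      p₁ (Units.map (algebraMap _ (v.adicCompletion K × v.adicCompletion K)).toMonoidHom a) = a ∧
        p₂ (Units.map (algebraMap _ (v.adicCompletion K × v.adicCompletion K)).toMonoidHom a) = a :=
    fun a => ⟨Units.ext rfl, Units.ext rfl⟩
  let μ₁ : LemD1.MuSet S :=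
    ⟨μ₁',
      fun x => by rw [hμ₁', Units.val_div_eq_div_val, norm_div, hνnorm, hνnorm, div_one],
      by
        have hc₁ : Continuous fun x : (v.adicCompletion K × v.adicCompletion K)ˣ => ((ν (p₁ x) : ℂˣ) : ℂ) :=
          hνcont.comp (Continuous.units_map _ (by exact continuous_fst))
        have hc₂ : Continuous fun x : (v.adicCompletion K × v.adicCompletion K)ˣ => ((ν (p₂ x) : ℂˣ) : ℂ) :=
          hνcont.comp (Continuous.units_map _ (by exact continuous_snd))
        have heq : (fun x : (v.adicCompletion K × v.adicCompletion K)ˣ => ((μ₁' x : ℂˣ) : ℂ)) =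
            fun x => ((ν (p₁ x) : ℂˣ) : ℂ) / ((ν (p₂ x) : ℂˣ) : ℂ) := by
          funext x; rw [hμ₁', Units.val_div_eq_div_val]
        rw [heq]
        exact hc₁.div₀ hc₂ fun x => Units.ne_zero _,
      fun a => iff_of_true (by rw [hμ₁', (hp_alg a).1, (hp_alg a).2, div_self']) (hnormRHS a)⟩
  have hμne : μ₁ ≠ μ₀ := by
    intro h
    have h' := congrArg (fun μ : LemD1.MuSet S => μ.1 (MulEquiv.prodUnits.symm (ϖ, 1))) h
    have hfst : p₁ (MulEquiv.prodUnits.symm (ϖ, 1)) = ϖ := Units.ext rfl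
    have hsnd : p₂ (MulEquiv.prodUnits.symm (ϖ, 1)) = 1 := Units.ext rfl
    change μ₁' (MulEquiv.prodUnits.symm (ϖ, 1)) =
      (1 : (v.adicCompletion K × v.adicCompletion K)ˣ →* ℂˣ) (MulEquiv.prodUnits.symm (ϖ, 1)) at h'
    rw [MonoidHom.one_apply, hμ₁', hfst, hsnd, map_one, div_one, hνϖ] at h'
    exact hζne h'
  -- the carriers: lines `ℂ` with `U(V)(F) ≅ GL₃(F)` acting through `t ∘ det`, `t ∈ {1, ν, sgn}`
  let lam : ((v.adicCompletion K)ˣ →* ℂˣ) → (S.U →* ℂˣ) := fun t =>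
    t.comp (Matrix.GeneralLinearGroup.det.comp (unitaryToGL 1 hH h23 h2))
  have hlam : ∀ t (g : S.U), lam t g = t (Matrix.GeneralLinearGroup.det (unitaryToGL 1 hH h23 h2 g)) := fun t g => rfl
  let ω : ((v.adicCompletion K)ˣ →* ℂˣ) → Representation ℂ S.U ℂ := fun t =>
    (DistribMulAction.toModuleEnd ℂ ℂ).comp (lam t)
  have hω : ∀ t (g : S.U) (x : ℂ), ω t g x = (lam t g : ℂ) * x := fun t g x => by
    change (lam t g : ℂˣ) • x = _
    rw [Units.smul_def, smul_eq_mul]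
  -- on the centre `E¹`: `(t ∘ det)(a · 1) = t(a)³`
  have hcen : ∀ t (z : S.normOne), lam t (S.scalar z) = t (normOneToUnits 1 hH h23 h2 z) ^ 3 := by
    intro t z
    rw [hlam, ← unitaryEquiv_apply, unitaryEquiv_scalar, normOneEquiv_apply]
    have hdet : Matrix.GeneralLinearGroup.det
        (OscillatorStandingData.unitScalar 3 (normOneToUnits 1 hH h23 h2 z)) = (normOneToUnits 1 hH h23 h2 z) ^ 3 := by
      apply Units.ext
      simp [Matrix.GeneralLinearGroup.val_det_apply, OscillatorStandingData.coe_unitScalar, Matrix.scalar_apply,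
        Matrix.det_diagonal, Finset.prod_const]
    rw [hdet, map_pow]
  have hcen1 : ∀ z : S.normOne, lam 1 (S.scalar z) = χ₁.1 z := fun z => by
    rw [hcen]; change (1 : ℂˣ) ^ 3 = 1; rw [one_pow]
  have hcenν : ∀ z : S.normOne, lam ν (S.scalar z) = χ₁.1 z := fun z => by
    rw [hcen, hν3]; rfl
  have hcens : ∀ z : S.normOne, lam sgn (S.scalar z) = χ₂.1 z := fun z => by
    rw [hcen]; exact (hχ₂' z).symm
  -- `t ∘ det` is trivial on the open neighbourhood `{v(det g¹) = 1}` of `1` when `t` is unramified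
  have hopen : ∀ t, (∀ x : (v.adicCompletion K)ˣ, Valued.v (x : v.adicCompletion K) = 1 → t x = 1) →
      ∃ O : Set S.U, IsOpen O ∧ (1 : S.U) ∈ O ∧ ∀ g ∈ O, lam t g = 1 := by
    intro t ht
    refine ⟨{g : S.U | Valued.v ((((g : GL (Fin 3) (v.adicCompletion K × v.adicCompletion K)) :
        Matrix (Fin 3) (Fin 3) (v.adicCompletion K × v.adicCompletion K)).map (RingHom.fst _ _)).det) = 1}, ?_, ?_, ?_⟩
    · have hc : Continuous fun g : S.U => ((((g : GL (Fin 3) (v.adicCompletion K × v.adicCompletion K)) :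
          Matrix (Fin 3) (Fin 3) (v.adicCompletion K × v.adicCompletion K)).map (RingHom.fst _ _)).det) :=
        ((Units.continuous_val.comp continuous_subtype_val).matrix_map (by exact continuous_fst)).matrix_det
      have hO : IsOpen {y : v.adicCompletion K | Valued.v y = 1} := by
        rw [isOpen_iff_mem_nhds]
        intro y hy
        rw [Set.mem_setOf_eq] at hy
        have hnh := Valued.locally_const (x := y) (by rw [hy]; exact one_ne_zero)
        rwa [hy] at hnh
      exact hO.preimage hc
    · simp [Matrix.map_one]
    · intro g hg
      rw [hlam]
      exact ht _ hg
  have hopen1 : ∃ O : Set S.U, IsOpen O ∧ (1 : S.U) ∈ O ∧ ∀ g ∈ O, lam 1 g = 1 := hopen 1 fun _ _ => rfl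
  -- the test element `g₀ = diag(ϖ, 1, 1)`: `(t ∘ det)(g₀) = t(ϖ)`
  have hA₀det : (Matrix.diagonal ![(ϖ : v.adicCompletion K), 1, 1]).det ≠ 0 := by
    simp [Matrix.det_diagonal, Fin.prod_univ_three]
  let A₀ : GL (Fin 3) (v.adicCompletion K) := Matrix.GeneralLinearGroup.mkOfDetNeZero _ hA₀det
  have hdetA₀ : Matrix.GeneralLinearGroup.det A₀ = ϖ := by
    apply Units.ext
    simp [A₀, Matrix.GeneralLinearGroup.val_det_apply, Matrix.det_diagonal, Fin.prod_univ_three]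
  let g₀ : S.U := unitaryOfGL 1 hH h23 h2 A₀
  have hg₀ : ∀ t, lam t g₀ = t ϖ := fun t => by
    rw [hlam, unitaryToGL_unitaryOfGL, hdetA₀]
  have hν1 : lam ν ≠ lam 1 := fun h => hζne (by rw [← hνϖ, ← hg₀ ν, h, hg₀]; rfl)
  have hs1 : lam sgn ≠ lam 1 := fun h => hm1 (by rw [← hsϖ, ← hg₀ sgn, h, hg₀]; rfl)
  have hsν : lam sgn ≠ lam ν := fun h => hζm1 (by rw [← hsϖ, ← hνϖ, ← hg₀ sgn, ← hg₀ ν, h])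
  -- the item-(1) certificate of a character member, and the isomorphism criterion, packaged on `S`
  have hI1 : ∀ (t : (v.adicCompletion K)ˣ →* ℂˣ) (χ : LemD1.ChiSet S) (μ : LemD1.MuSet S) (ε : LemD1.EpsRep S),
      (∀ z : S.normOne, lam t (S.scalar z) = χ.1 z) → (∃ O : Set S.U, IsOpen O ∧ (1 : S.U) ∈ O ∧ ∀ g ∈ O, lam t g = 1) →
      LemD1_1AsPrinted
        ({ isNonarchimedeanLocalField := inferInstance, isModuleTopology := inferInstance, S := S, eps := ε.1,
           eps_mem_skew := ε.2, mu := μ.1, norm_mu := μ.2.1, continuous_mu := μ.2.2.1,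
           mu_algebraMap_eq_one_iff := μ.2.2.2, chi := χ.1, norm_chi := χ.2.1, continuous_chi := χ.2.2,
           omega := ω t } : LemD1Data (v.adicCompletion K) (v.adicCompletion K × v.adicCompletion K) 3 ℂ) :=
    fun t χ μ ε hc ho =>
      LemD1IndexedNonVacuity.lemD1_1AsPrinted_of_character _ (lam t) (hω t) hc ho (not_isField (v.adicCompletion K))
  have hN : ∀ (t : (v.adicCompletion K)ˣ →* ℂˣ) (χ : LemD1.ChiSet S), (∀ z : S.normOne, lam t (S.scalar z) = χ.1 z) →
      augmentation (ω t) S.scalar χ.1 = ⊥ := fun t χ hc =>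
    augmentation_eq_bot_of_character (ω t) S.scalar χ.1 (lam t) (hω t) hc
  have hiso : ∀ (t t' : (v.adicCompletion K)ˣ →* ℂˣ) (χ χ' : LemD1.ChiSet S),
      (∀ z : S.normOne, lam t (S.scalar z) = χ.1 z) → (∀ z : S.normOne, lam t' (S.scalar z) = χ'.1 z) →
      (AreIsomorphicRep (quotRep (ω t) S.scalar_mem_center χ.1) (quotRep (ω t') S.scalar_mem_center χ'.1) ↔
        lam t = lam t') := fun t t' χ χ' hc hc' =>
    areIsomorphicRep_quotRep_iff_of_character (ω t) (ω t') S.scalar_mem_center χ.1 χ'.1 (lam t) (lam t') (hω t) (hω t')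
      (hN t χ hc) (hN t' χ' hc')
  refine ⟨?_, ?_, ?_⟩
  · -- (a) the four-member slot-wise collection
    let Lf : LemD1IndexedFamily (v.adicCompletion K) (v.adicCompletion K × v.adicCompletion K) 3 (Fin 4) :=
      { isNonarchimedeanLocalField := inferInstance
        isModuleTopology := inferInstance
        S := S
        mu := ![μ₀, μ₁, μ₀, μ₀]
        eps := ![e, e, e, e']
        chi := ![χ₁, χ₁, χ₂, χ₁]
        V := fun _ => ℂ
        omega := ![ω 1, ω ν, ω sgn, ω 1] }
    have hItem1 : Lf.Item1AsPrinted := by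
      intro i
      fin_cases i
      · exact hI1 1 χ₁ μ₀ e hcen1 hopen1
      · exact hI1 ν χ₁ μ₁ e hcenν (hopen ν hνone)
      · exact hI1 sgn χ₂ μ₀ e hcens (hopen sgn hsone)
      · exact hI1 1 χ₁ μ₀ e' hcen1 hopen1
    have h10 : ¬ AreIsomorphicRep (Lf.quot 1) (Lf.quot 0) := fun h => hν1 ((hiso ν 1 χ₁ χ₁ hcenν hcen1).1 h)
    have h20 : ¬ AreIsomorphicRep (Lf.quot 2) (Lf.quot 0) := fun h => hs1 ((hiso sgn 1 χ₂ χ₁ hcens hcen1).1 h)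
    have h21 : ¬ AreIsomorphicRep (Lf.quot 2) (Lf.quot 1) := fun h => hsν ((hiso sgn ν χ₂ χ₁ hcens hcenν).1 h)
    have h30 : AreIsomorphicRep (Lf.quot 3) (Lf.quot 0) := (hiso 1 1 χ₁ χ₁ hcen1 hcen1).2 rfl
    have h03 : AreIsomorphicRep (Lf.quot 0) (Lf.quot 3) := (hiso 1 1 χ₁ χ₁ hcen1 hcen1).2 rfl
    have hItem3 : LemD1_3AsPrintedI Lf := by
      intro _ i j
      fin_cases i <;> fin_cases j
      · exact iff_of_true (AreIsomorphicRep.refl _) ⟨rfl, hsc _ _, rfl⟩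
      · exact iff_of_false h10 fun h => hμne h.1
      · exact iff_of_false h20 fun h => hχne h.2.2
      · exact iff_of_true h30 ⟨rfl, hsc _ _, rfl⟩
      · exact iff_of_false (fun h => h10 h.symm) fun h => hμne h.1.symm
      · exact iff_of_true (AreIsomorphicRep.refl _) ⟨rfl, hsc _ _, rfl⟩
      · exact iff_of_false h21 fun h => hμne h.1.symm
      · exact iff_of_false (fun h => h10 (h03.trans h).symm) fun h => hμne h.1.symm
      · exact iff_of_false (fun h => h20 h.symm) fun h => hχne h.2.2.symm
      · exact iff_of_false (fun h => h21 h.symm) fun h => hμne h.1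
      · exact iff_of_true (AreIsomorphicRep.refl _) ⟨rfl, hsc _ _, rfl⟩
      · exact iff_of_false (fun h => h20 (h03.trans h).symm) fun h => hχne h.2.2.symm
      · exact iff_of_true h03 ⟨rfl, hsc _ _, rfl⟩
      · exact iff_of_false (fun h => h10 (h.trans h30)) fun h => hμne h.1
      · exact iff_of_false (fun h => h20 (h.trans h30)) fun h => hχne h.2.2
      · exact iff_of_true (AreIsomorphicRep.refl _) ⟨rfl, hsc _ _, rfl⟩
    exact ⟨Lf, hItem1, hItem3, ⟨hμne, rfl, rfl, h10⟩, ⟨rfl, rfl, hχne, h20⟩, ⟨rfl, hee', hsc _ _, rfl, h30⟩, h21⟩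
  · -- (b) identical labels, non-isomorphic carriers: item (1) holds, item (3) fails
    let Lf : LemD1IndexedFamily (v.adicCompletion K) (v.adicCompletion K × v.adicCompletion K) 3 (Fin 2) :=
      { isNonarchimedeanLocalField := inferInstance
        isModuleTopology := inferInstance
        S := S
        mu := fun _ => μ₀
        eps := fun _ => e
        chi := fun _ => χ₁
        V := fun _ => ℂ
        omega := ![ω 1, ω ν] }
    have hItem1 : Lf.Item1AsPrinted := by
      intro i
      fin_cases i
      · exact hI1 1 χ₁ μ₀ e hcen1 hopen1
      · exact hI1 ν χ₁ μ₀ e hcenν (hopen ν hνone)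
    have h10 : ¬ AreIsomorphicRep (Lf.quot 1) (Lf.quot 0) := fun h => hν1 ((hiso ν 1 χ₁ χ₁ hcenν hcen1).1 h)
    refine ⟨Lf, hItem1, fun h3 => h10 ((h3 le_rfl 0 1).2 ⟨rfl, hsc _ _, rfl⟩), rfl, rfl, rfl, h10⟩
  · -- (c) a line with the WRONG central character: the maximal `χ`-quotient of `sgn ∘ det` for `χ = 1` is zero
    let Lf : LemD1IndexedFamily (v.adicCompletion K) (v.adicCompletion K × v.adicCompletion K) 3 (Fin 1) :=
      { isNonarchimedeanLocalField := inferInstance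
        isModuleTopology := inferInstance
        S := S
        mu := fun _ => μ₀
        eps := fun _ => e
        chi := fun _ => χ₁
        V := fun _ => ℂ
        omega := fun _ => ω sgn }
    have htop : augmentation (ω sgn) S.scalar χ₁.1 = ⊤ := by
      rw [eq_top_iff]
      rintro y -
      unfold augmentation
      refine Submodule.mem_iSup_of_mem (normOneOfUnit 1 hH h23 h2 ϖ) ⟨-(y / 2), ?_⟩
      simp only [LinearMap.sub_apply, LinearMap.smul_apply, LinearMap.id_coe, id_eq]
      rw [hω, hcen, ← hχ₂', hχ₂ϖ]
      change (((-1 : ℂˣ) : ℂ)) * -(y / 2) - (((1 : ℂˣ) : ℂ)) • -(y / 2) = y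
      rw [Units.val_neg, Units.val_one, smul_eq_mul]
      ring
    have hsub : Subsingleton (ℂ ⧸ augmentation (ω sgn) S.scalar χ₁.1) :=
      Submodule.Quotient.subsingleton_iff.2 htop
    have hItem3 : LemD1_3AsPrintedI Lf := by
      intro _ i j
      fin_cases i; fin_cases j
      exact iff_of_true (AreIsomorphicRep.refl _) ⟨rfl, hsc _ _, rfl⟩
    refine ⟨Lf, hItem3, fun h1 => not_isField (v.adicCompletion K) ((h1 0).2.1 hsub).1, ?_, hsub⟩
    change Nontrivial ℂ
    infer_instance

/-- **THE SLOT-WISE CERTIFICATE.**  At a SPLIT place — `F = K_v` (any number field `K`, any finite place `v`), `E = F × F` with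
the swap (the tree's `splitData`, Gram matrix `(1, 1)`), `n = 3` — there is a four-member collection
`Lf : LemD1IndexedFamily F E 3 (Fin 4)` satisfying «Lemma D.1 (1) for every member» AND «Lemma D.1 (3)» (all sixteen pairs),
whose members, relative to member `0` = `(μ, ε, χ; ω) = (1, (1,−1), 1; trivial line)`, are:
`1` = `(ν ⊠ ν⁻¹, (1,−1), 1; ν ∘ det)` — differs ONLY in `μ` («write `μ = ν ⊠ ν⁻¹`», l. 5241), and `ω₁ ≇ ω₀`;
`2` = `(1, (1,−1), sgn³; sgn ∘ det)` — differs ONLY in `χ`, and `ω₂ ≇ ω₀`;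
`3` = `(1, (ϖ,−ϖ), 1; trivial line)` — differs ONLY in the REPRESENTATIVE of `ε` (same class in `E^{−×}/Nm E^×`), and `ω₃ ≅ ω₀`;
moreover `ω₂ ≇ ω₁`.  (`ν`, `sgn` = the unramified characters `ζ₃^{ord}`, `(−1)^{ord}` of `F^×`; `ϖ` a uniformiser.)
Each slot of the printed «`(μ', ε', χ') = (μ, ε, χ)`» is thus exercised at both truth values in ONE model of the record pair.
No statement about Liu's objects. [cite: Liu2021, App. D Lemma D.1 (1) and (3)] -/
theorem exists_lemD1IndexedFamily_slots :
    ∃ Lf : LemD1IndexedFamily (v.adicCompletion K) (v.adicCompletion K × v.adicCompletion K) 3 (Fin 4),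
      Lf.Item1AsPrinted ∧ LemD1_3AsPrintedI Lf ∧
      (Lf.mu 1 ≠ Lf.mu 0 ∧ Lf.eps 1 = Lf.eps 0 ∧ Lf.chi 1 = Lf.chi 0 ∧ ¬ AreIsomorphicRep (Lf.quot 1) (Lf.quot 0)) ∧
      (Lf.mu 2 = Lf.mu 0 ∧ Lf.eps 2 = Lf.eps 0 ∧ Lf.chi 2 ≠ Lf.chi 0 ∧ ¬ AreIsomorphicRep (Lf.quot 2) (Lf.quot 0)) ∧
      (Lf.mu 3 = Lf.mu 0 ∧ Lf.eps 3 ≠ Lf.eps 0 ∧ LemD1.SameClass (Lf.eps 0) (Lf.eps 3) ∧ Lf.chi 3 = Lf.chi 0 ∧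
        AreIsomorphicRep (Lf.quot 3) (Lf.quot 0)) ∧
      ¬ AreIsomorphicRep (Lf.quot 2) (Lf.quot 1) :=
  (certificates K v).1

/-- **The `χ`-slot**: the two printed records, read on an indexed collection, do NOT by their shape force «all members
carry the same Step-3 character `χ`» (member `2` of the certificate). [cite: Liu2021, App. D Lemma D.1 (1) and (3)] -/
theorem not_forall_chi_eq_of_item1AsPrinted_of_lemD1_3AsPrintedI :
    ¬ ∀ Lf : LemD1IndexedFamily (v.adicCompletion K) (v.adicCompletion K × v.adicCompletion K) 3 (Fin 4),
        Lf.Item1AsPrinted → LemD1_3AsPrintedI Lf → ∀ i j : Fin 4, Lf.chi i = Lf.chi j := by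
  intro h
  obtain ⟨Lf, h1, h3, -, ⟨-, -, hne, -⟩, -⟩ := exists_lemD1IndexedFamily_slots K v
  exact hne (h Lf h1 h3 2 0)

/-- **The `ε`-slot (READING L3′)**: item (3) as typed identifies REPRESENTATIVES of one class of `E^{−×}/Nm E^×` — isomorphic
members need not have equal representatives `eps` (members `0`, `3` of the certificate: `(1, −1)` versus `(ϖ, −ϖ)`), only
`SameClass` ones, exactly as Step 1 and its footnote say («the resulting oscillator representation depends only on `ε`»).
[cite: Liu2021, App. D Lemma D.1 (3) and §D.1 Step 1 (l. 5217)] -/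
theorem not_forall_eps_eq_of_areIsomorphicRep_of_lemD1_3AsPrintedI :
    ¬ ∀ Lf : LemD1IndexedFamily (v.adicCompletion K) (v.adicCompletion K × v.adicCompletion K) 3 (Fin 4),
        Lf.Item1AsPrinted → LemD1_3AsPrintedI Lf →
          ∀ i j : Fin 4, AreIsomorphicRep (Lf.quot j) (Lf.quot i) → Lf.eps j = Lf.eps i := by
  intro h
  obtain ⟨Lf, h1, h3, -, -, ⟨-, hne, -, -, hiso⟩, -⟩ := exists_lemD1IndexedFamily_slots K v
  exact hne (h Lf h1 h3 0 3 hiso)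

/-! ## §5 The two records are independent by shape -/

/-- **Item (1) does not imply item (3)**: a two-member collection (split place, `n = 3`) with IDENTICAL labels
`(μ, ε, χ) = (1, (1,−1), 1)` on the NON-isomorphic carriers `1` and `ν ∘ det` satisfies Lemma D.1 (1) member by member but
violates Lemma D.1 (3) (equal triples, non-isomorphic `ω`'s).  So the END's row `hD3` is not redundant given `hD1″` by shape;
item (3) is a genuine label ↔ carrier constraint. [cite: Liu2021, App. D Lemma D.1 (1) and (3)] -/
theorem exists_item1AsPrinted_and_not_lemD1_3AsPrintedI :
    ∃ Lf : LemD1IndexedFamily (v.adicCompletion K) (v.adicCompletion K × v.adicCompletion K) 3 (Fin 2),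
      Lf.Item1AsPrinted ∧ ¬ LemD1_3AsPrintedI Lf ∧
      Lf.mu 1 = Lf.mu 0 ∧ Lf.eps 1 = Lf.eps 0 ∧ Lf.chi 1 = Lf.chi 0 ∧ ¬ AreIsomorphicRep (Lf.quot 1) (Lf.quot 0) :=
  (certificates K v).2.1

/-- **Item (3) does not imply item (1)**: a one-member collection (split place, `n = 3`) whose carrier is the NON-ZERO line
`sgn ∘ det` labelled with `χ = 1` — the WRONG central character (`sgn ∘ det` has central character `a ↦ sgn(a)³ = sgn(a)`) —
satisfies Lemma D.1 (3) (one reflexive pair) while its maximal `χ`-quotient `ω(μ, ε, χ)` is ZERO, which Lemma D.1 (1) forbids at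
`n = 3` over `E = F × F` (not a field).  So `hD1″` is not redundant given `hD3` by shape, and the non-vanishing clause of (1)
has content even for non-zero `ω(μ, ε)`. [cite: Liu2021, App. D Lemma D.1 (1) and (3)] -/
theorem exists_lemD1_3AsPrintedI_and_not_item1AsPrinted :
    ∃ Lf : LemD1IndexedFamily (v.adicCompletion K) (v.adicCompletion K × v.adicCompletion K) 3 (Fin 1),
      LemD1_3AsPrintedI Lf ∧ ¬ Lf.Item1AsPrinted ∧ Nontrivial (Lf.V 0) ∧
      Subsingleton (Lf.V 0 ⧸ augmentation (Lf.omega 0) Lf.S.scalar (Lf.chi 0).1) :=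
  (certificates K v).2.2

end Certificate

end LemD1IndexedNonVacuitySlots

end Literature.NumberTheory.Automorphic.Liu2021

end
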